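import Summits.HodgeConjecture.HodgeConjecture.Theses.PadicSemiregularLift
import Literature.AlgebraicGeometry.Deformation.GrothendieckExistenceVectorBundlesProofs

/-!
# `FormalVectorBundlesAlgebraize` from Grothendieck's existence theorem for vector bundles (conditional)

The crux `PadicSemiregularLift.FormalVectorBundlesAlgebraize` (stmt-HodgeConjecture-14106) is the
`W(k)`-instance of Grothendieck's existence theorem ("formal GAGA") for vector bundles on a proper scheme
(Görtz–Wedhorn II, Thm. 24.94 with Prop. 24.95 and Lemma 24.96). This file records the CONDITIONAL
derivation from the tree's named fact
`Literature.AlgebraicGeometry.Deformation.GortzWedhorn2023_thm2494_vectorBundle_witt` (an unproved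
`def … : Prop`), through its lifting-vocabulary corollary
`GortzWedhorn2023_thm2494_vectorBundle_witt.liftsTo_of_liftsFormally`: only properness of `𝒳 → Spec W`
(`IsSmoothProperModel.isProper`) is used. The unconditional proof is the business of the reduction line
`chow-zariski-pushforward` of the crux.
-/

open CategoryTheory AlgebraicGeometry
open Literature.AlgebraicGeometry.Motives Literature.AlgebraicGeometry.Motives.WittScheme
open Literature.AlgebraicGeometry.Deformation

-- Summit.HodgeConjecture.HodgeConjecture.… repeats the summit name by the D-0017 layout (Sub = Summit).
set_option linter.dupNamespace false

namespace Summit.HodgeConjecture.HodgeConjecture.Theorems.FormalVectorBundlesAlgebraize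

/-- **`FormalVectorBundlesAlgebraize`, conditionally on Grothendieck's existence theorem for vector bundles
over `W(k)`** (the named fact `GortzWedhorn2023_thm2494_vectorBundle_witt`, Görtz–Wedhorn II Thm. 24.94 +
Prop. 24.95): a vector bundle on the special fibre of a smooth proper `W(k)`-scheme that lifts formally lifts
algebraically. -/
theorem formalVectorBundlesAlgebraize_of_thm2494 (h : GortzWedhorn2023_thm2494_vectorBundle_witt) :
    Summit.HodgeConjecture.HodgeConjecture.Theses.PadicSemiregularLift.FormalVectorBundlesAlgebraize :=
  fun _ _ _ _ _ _ _ _ h𝒳 _ hE => h.liftsTo_of_liftsFormally h𝒳.isProper hE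

end Summit.HodgeConjecture.HodgeConjecture.Theorems.FormalVectorBundlesAlgebraize
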